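import Literature.NumberTheory.DiophantineApproximation.RhinViolaIntegrals
import Mathlib.Algebra.Polynomial.HasseDeriv
import Mathlib.Algebra.Polynomial.Taylor
import HarnessLib

/-!
# The Rhin–Viola mixed integral `I_z^{(1)}(h,j,k,l,m)` in residue form, and `I_z = I_z^{(0)} − (log z) I_z^{(1)}`

Topic `Literature/NumberTheory/DiophantineApproximation`. DEFINITIONS (`innerRes`, `I1`, `I`) with proved
API; no named facts. Source: G. Rhin, C. Viola, *The permutation group method for the dilogarithm*, Ann.
Sc. Norm. Super. Pisa Cl. Sci. (5) 4 (2005) 389–437, (2.2), (2.4), (2.10)–(2.11), Lemma 2.3: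

  `I_z^{(1)}(h,j,k,l,m) = z^{−l−m} ∫₀¹ ( (1/2πi) ∮_{|y − x/(x−z)| = ϱ} x^j(1−x)^h y^k(1−y)^l dy`
      `/ (x(1−y)+yz)^{j+k−m+1} ) dx`   (2.2)

and `I_z := I_z^{(0)} − (log z) I_z^{(1)}` (2.4). **Residue form.** For fixed `x ≠ z` one has
`x(1−y) + yz = (z − x)(y − y₀)` with `y₀ = x/(x−z)`, so the inner contour integral is the residue at the pole
`y₀` of order `n = j+k−m+1` of `g(y)/((z−x)^n (y−y₀)^n)`, `g(y) = x^j(1−x)^h y^k(1−y)^l` a polynomial in `y`;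
by Cauchy's differentiation formula it equals `g^{(n−1)}(y₀)/((n−1)! (z−x)^n) = (D^{(n−1)} g)(y₀)/(z−x)^n`
with `D^{(n−1)}` the Hasse derivative (`Polynomial.hasseDeriv`), and it is `0` when `n ≤ 0` (the integrand is
then a polynomial in `y`). E.g. for all parameters `0`: `(1/2πi)∮ dy/(x(1−y)+yz) = 1/(z−x)` (RV (2.10)). We
take this residue expression as the DEFINITION of the inner integral (`innerRes`), which makes `I_z^{(1)}` an
ordinary one-dimensional integral of a rational function of `x` over `[0,1]` (for `z > 1` the pole
`y₀ = x/(x−z) ≤ 0` and `z − x ≥ z − 1 > 0`, so no singularity is met), and prove Lemma 2.3 of the paper in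
this vocabulary: `I_z^{(1)}(0,…,0) = Li₁(1/z)` (2.11) and `I_z(0,…,0) = Li₂(1/z)`.
The double residue `I_z^{(2)}` (2.3) is NOT defined here.

## References

* G. Rhin, C. Viola, Ann. Sc. Norm. Super. Pisa Cl. Sci. (5) 4 (2005) 389–437, (2.2), (2.4), (2.10), (2.11),
  Lemma 2.3. [RhinViola2005]
-/

noncomputable section

namespace Literature.NumberTheory.DiophantineApproximation

namespace RhinViola

open _root_.MeasureTheory _root_.Set intervalIntegral Polynomial
open DilogPade (polylogSeries)

/-- **The inner contour integral of (2.2) in residue form**: for the pole `y₀ = x/(x−z)` of order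
`n = j+k−m+1` of `y^k(1−y)^l/(x(1−y)+yz)^n = y^k(1−y)^l/((z−x)^n (y−y₀)^n)`,
`(1/2πi)∮_{|y−y₀|=ϱ} y^k(1−y)^l dy/(x(1−y)+yz)^n = (D^{(n−1)}(Y^k(1−Y)^l))(y₀)/(z−x)^n` (Hasse derivative;
Cauchy's differentiation formula), and `0` if `n ≤ 0`. The factor `x^j(1−x)^h` is kept outside.
[cite: RhinViola2005, (2.2) and (2.10)] -/
def innerRes (z : ℝ) (j k l m : ℕ) (x : ℝ) : ℝ :=
  if m ≤ j + k then
    (hasseDeriv (j + k - m) ((X : ℝ[X]) ^ k * (1 - X) ^ l)).eval (x / (x - z)) / (z - x) ^ (j + k - m + 1)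
  else 0

/-- **`I_z^{(1)}(h, j, k, l, m)`** (Rhin–Viola (2.2)) in residue form:
`z^{−l−m} ∫₀¹ x^j (1−x)^h · innerRes(x) dx`. [cite: RhinViola2005, (2.2)] -/
def I1 (z : ℝ) (h j k l m : ℕ) : ℝ :=
  z ^ (-((l : ℤ) + m)) * ∫ x in (0 : ℝ)..1, x ^ j * (1 - x) ^ h * innerRes z j k l m x

/-- **`I_z(h, j, k, l, m) = I_z^{(0)} − (log z) I_z^{(1)}`** (Rhin–Viola (2.4); `log z` the real logarithm).
[cite: RhinViola2005, (2.4)] -/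
def I (z : ℝ) (h j k l m : ℕ) : ℝ :=
  I0 z h j k l m - Real.log z * I1 z h j k l m

/-! ### Elementary API -/

/-- The factorisation behind the residue form: `x(1−y) + yz = (z − x)(y − x/(x−z))` for `x ≠ z`.
[cite: RhinViola2005, (2.5) and (2.10)] -/
theorem denom_eq_mul_sub {x z : ℝ} (hxz : x ≠ z) (y : ℝ) :
    x * (1 - y) + y * z = (z - x) * (y - x / (x - z)) := by
  have : x - z ≠ 0 := sub_ne_zero.2 hxz
  field_simp
  ring

/-- When `j + k < m` (the inner integrand is a polynomial in `y`) the inner residue vanishes, hence so does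
`I_z^{(1)}` (Rhin–Viola, proof of Lemma 2.2). [cite: RhinViola2005, Lemma 2.2] -/
theorem innerRes_of_lt {z : ℝ} {j k l m : ℕ} (hm : j + k < m) (x : ℝ) : innerRes z j k l m x = 0 := by
  rw [innerRes, if_neg (by omega)]

/-- `I_z^{(1)}(h,j,k,l,m) = 0` when `j + k < m`. [cite: RhinViola2005, Lemma 2.2] -/
theorem I1_of_lt {z : ℝ} (h : ℕ) {j k l m : ℕ} (hm : j + k < m) : I1 z h j k l m = 0 := by
  simp [I1, innerRes_of_lt hm]

/-- With all parameters `0` the inner residue is `1/(z − x)` — RV (2.10):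
`(1/2πi)∮ dy/(x(1−y)+yz) = 1/(z−x)`. [cite: RhinViola2005, (2.10)] -/
theorem innerRes_zero (z x : ℝ) : innerRes z 0 0 0 0 x = 1 / (z - x) := by
  simp [innerRes]

/-- **RV (2.11)**: `I_z^{(1)}(0,0,0,0,0) = ∫₀¹ dx/(z−x) = Li₁(1/z)` for `z > 1`. [cite: RhinViola2005, (2.11)] -/
theorem I1_zero {z : ℝ} (hz : 1 < z) : I1 z 0 0 0 0 0 = polylogSeries 1 (1 / z) := by
  rw [I1, ← integral_one_div_sub hz]
  simp [innerRes_zero]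

/-- **Rhin–Viola 2005, Lemma 2.3**: `I_z(0,0,0,0,0) = Li₂(1/z)` for `z > 1`
(`I^{(0)} = log z · Li₁(1/z) + Li₂(1/z)`, `I^{(1)} = Li₁(1/z)`). [cite: RhinViola2005, Lemma 2.3] -/
theorem I_zero {z : ℝ} (hz : 1 < z) : I z 0 0 0 0 0 = polylogSeries 2 (1 / z) := by
  rw [I, I0_zero hz, I1_zero hz]
  ring

/-- The inner residue is a continuous function of `x` on `[0,1]` when `z > 1` (denominators `x − z`,
`z − x` do not vanish there). [folklore] -/
theorem continuousOn_innerRes {z : ℝ} (hz : 1 < z) (j k l m : ℕ) :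
    ContinuousOn (innerRes z j k l m) (Icc (0 : ℝ) 1) := by
  unfold innerRes
  split_ifs with hm
  · refine ContinuousOn.div ?_ (by fun_prop) fun x hx => pow_ne_zero _ (by linarith [hx.2])
    refine (Polynomial.continuous _).comp_continuousOn ?_
    exact continuousOn_id.div (continuousOn_id.sub continuousOn_const) fun x hx => by linarith [hx.2]
  · exact continuousOn_const

/-- Hence the integrand of `I_z^{(1)}` is interval-integrable on `[0,1]` for `z > 1`. [folklore] -/
theorem intervalIntegrable_I1_integrand {z : ℝ} (hz : 1 < z) (h j k l m : ℕ) :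
    IntervalIntegrable (fun x : ℝ => x ^ j * (1 - x) ^ h * innerRes z j k l m x) volume 0 1 := by
  refine ContinuousOn.intervalIntegrable ?_
  rw [uIcc_of_le zero_le_one]
  exact (by fun_prop : Continuous fun x : ℝ => x ^ j * (1 - x) ^ h).continuousOn.mul
    (continuousOn_innerRes hz j k l m)

/-! ### Cross-check with Rhin–Viola's Lemma 2.4 (`h = j = l = m = 0`, `k > 0`) -/

/-- RV, proof of Lemma 2.4: `(1/2πi)∮ y^k dy/(x(1−y)+yz)^{k+1} = 1/(z−x)^{k+1}` — the residue form gives the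
same value (`D^{(k)} Y^k = 1`). [cite: RhinViola2005, Lemma 2.4 (proof)] -/
theorem innerRes_zero_k (z : ℝ) (k : ℕ) (x : ℝ) : innerRes z 0 k 0 0 x = 1 / (z - x) ^ (k + 1) := by
  rw [innerRes, if_pos (Nat.zero_le _)]
  simp [X_pow_eq_monomial, hasseDeriv_monomial]

/-- **RV (2.16)**: `I_z^{(1)}(0,0,k,0,0) = ∫₀¹ dx/(z−x)^{k+1} = (1/k)(1/(z−1)^k − 1/z^k)` for `k > 0`, `z > 1`.
[cite: RhinViola2005, (2.16)] -/
theorem I1_zero_k {z : ℝ} (hz : 1 < z) {k : ℕ} (hk : 0 < k) :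
    I1 z 0 0 k 0 0 = 1 / k * (1 / (z - 1) ^ k - 1 / z ^ k) := by
  have hk0 : (k : ℝ) ≠ 0 := by exact_mod_cast hk.ne'
  have hzx : ∀ x ∈ uIcc (0 : ℝ) 1, z - x ≠ 0 := fun x hx => by
    rw [uIcc_of_le zero_le_one] at hx; linarith [hx.2]
  -- primitive `x ↦ (1/k) (z−x)^{-k}`, written with natural powers as `1/(k (z−x)^k)`
  have hderiv : ∀ x ∈ uIcc (0 : ℝ) 1,
      HasDerivAt (fun x : ℝ => 1 / (k * (z - x) ^ k)) (1 / (z - x) ^ (k + 1)) x := by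
    intro x hx
    have hzx' := hzx x hx
    have h1 : HasDerivAt (fun x : ℝ => (k : ℝ) * (z - x) ^ k) ((k : ℝ) * ((k : ℝ) * (z - x) ^ (k - 1) * -1)) x :=
      (((hasDerivAt_id x).const_sub z).pow k).const_mul (k : ℝ) |>.congr_deriv (by simp)
    have h2 := h1.inv (mul_ne_zero hk0 (pow_ne_zero _ hzx'))
    simp only [one_div]
    refine h2.congr_deriv ?_
    obtain ⟨k', rfl⟩ : ∃ k', k = k' + 1 := ⟨k - 1, by omega⟩
    simp only [Nat.add_sub_cancel]
    field_simp
    ring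
  have hcont : ContinuousOn (fun x : ℝ => 1 / (z - x) ^ (k + 1)) (uIcc (0 : ℝ) 1) :=
    continuousOn_const.div (by fun_prop) fun x hx => pow_ne_zero _ (hzx x hx)
  rw [I1]
  simp only [innerRes_zero_k, pow_zero, one_mul, Nat.cast_zero, add_zero, neg_zero, zpow_zero]
  rw [integral_eq_sub_of_hasDerivAt hderiv hcont.intervalIntegrable]
  have hz1 : z - 1 ≠ 0 := by linarith
  have hz0 : z ≠ 0 := by linarith
  field_simp
  ring

/-! ### The linear decomposition (2.29) for `I_z^{(1)}` and `I_z` -/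

/-- Pointwise (2.29) for the inner residue (`y = 1 − (1−y)` and linearity of the Hasse derivative; the pole
order `j+(k+1)−(m+1)+1 = j+k−m+1` is unchanged):
`innerRes(j,k+1,l,m+1) = innerRes(j,k,l,m) − innerRes(j,k,l+1,m)`. [cite: RhinViola2005, (2.29)] -/
theorem innerRes_succ_k_succ_m (z : ℝ) (j k l m : ℕ) (x : ℝ) :
    innerRes z j (k + 1) l (m + 1) x = innerRes z j k l m x - innerRes z j k (l + 1) m x := by
  unfold innerRes
  by_cases hm : m ≤ j + k
  · rw [if_pos (by omega), if_pos hm, if_pos hm, show j + (k + 1) - (m + 1) = j + k - m by omega]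
    have hpoly : ((X : ℝ[X]) ^ (k + 1) * (1 - X) ^ l) = X ^ k * (1 - X) ^ l - X ^ k * (1 - X) ^ (l + 1) := by
      ring
    rw [hpoly, map_sub, eval_sub, sub_div]
  · rw [if_neg (by omega), if_neg hm, if_neg hm, sub_zero]

/-- **Rhin–Viola (2.29) for `I_z^{(1)}`** (`z ≥ 1`; indices shifted so that `k, m ≥ 1` read `k+1, m+1`):
`I_z^{(1)}(h,j,k+1,l,m+1) = z^{−1} I_z^{(1)}(h,j,k,l,m) − I_z^{(1)}(h,j,k,l+1,m)`. [cite: RhinViola2005, (2.29)] -/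
theorem I1_succ_k_succ_m {z : ℝ} (hz : 1 < z) (h j k l m : ℕ) :
    I1 z h j (k + 1) l (m + 1) = z⁻¹ * I1 z h j k l m - I1 z h j k (l + 1) m := by
  have hz0 : z ≠ 0 := by positivity
  have hint : ∫ x in (0 : ℝ)..1, x ^ j * (1 - x) ^ h * innerRes z j (k + 1) l (m + 1) x =
      (∫ x in (0 : ℝ)..1, x ^ j * (1 - x) ^ h * innerRes z j k l m x)
        - ∫ x in (0 : ℝ)..1, x ^ j * (1 - x) ^ h * innerRes z j k (l + 1) m x := by
    rw [← integral_sub (intervalIntegrable_I1_integrand hz h j k l m)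
      (intervalIntegrable_I1_integrand hz h j k (l + 1) m)]
    refine integral_congr fun x _ => ?_
    simp only [innerRes_succ_k_succ_m]
    ring
  have p1 : z ^ (-((l : ℤ) + ((m + 1 : ℕ) : ℤ))) = z⁻¹ * z ^ (-((l : ℤ) + m)) := by
    rw [Nat.cast_succ, show -((l : ℤ) + ((m : ℤ) + 1)) = -((l : ℤ) + m) - 1 by ring, zpow_sub_one₀ hz0]
    ring
  have p2 : z ^ (-(((l + 1 : ℕ) : ℤ) + (m : ℤ))) = z⁻¹ * z ^ (-((l : ℤ) + m)) := by
    rw [Nat.cast_succ, show -(((l : ℤ) + 1) + m) = -((l : ℤ) + m) - 1 by ring, zpow_sub_one₀ hz0]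
    ring
  simp only [I1]
  rw [hint, p1, p2]
  ring

/-- **Rhin–Viola (2.29) for `I_z = I_z^{(0)} − (log z) I_z^{(1)}`** (`z > 1`): "Hence the same decomposition
holds also for `I_z(h,j,k,l,m)`". [cite: RhinViola2005, (2.29)] -/
theorem I_succ_k_succ_m {z : ℝ} (hz : 1 < z) (h j k l m : ℕ) :
    I z h j (k + 1) l (m + 1) = z⁻¹ * I z h j k l m - I z h j k (l + 1) m := by
  rw [I, I, I, I0_succ_k_succ_m hz.le, I1_succ_k_succ_m hz]
  ring

/-! ### The linear decomposition (2.41) for `I_z^{(1)}` and `I_z` -/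

/-- The inner residue as a Taylor coefficient at the pole: for `m ≤ j+k`,
`innerRes = (taylor_{y₀}(Y^k(1−Y)^l)).coeff (j+k−m) / (z−x)^{j+k−m+1}`, `y₀ = x/(x−z)`
(`Polynomial.taylor_coeff`). [folklore] -/
theorem innerRes_eq_taylor_coeff {z : ℝ} {j k l m : ℕ} (hm : m ≤ j + k) (x : ℝ) :
    innerRes z j k l m x =
      (taylor (x / (x - z)) ((X : ℝ[X]) ^ k * (1 - X) ^ l)).coeff (j + k - m) / (z - x) ^ (j + k - m + 1) := by
  rw [innerRes, if_pos hm, taylor_coeff]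

/-- **Pointwise (2.41) for the inner residue** (`x ≠ z`): from the polynomial identity
`(1−x)(1−Y) = z − (z−1)(1−Y) − (z−x)(Y − y₀)`, `y₀ = x/(x−z)`, and the shift of Taylor coefficients under
multiplication by `Y − y₀`,
`(1−x)·innerRes(j,k,l+1,m) = z·innerRes(j,k,l,m) − (z−1)·innerRes(j,k,l+1,m) − innerRes(j,k,l,m+1)`.
[cite: RhinViola2005, (2.41)] -/
theorem one_sub_mul_innerRes_succ_l {x z : ℝ} (hxz : x ≠ z) (j k l m : ℕ) :
    (1 - x) * innerRes z j k (l + 1) m x =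
      z * innerRes z j k l m x - (z - 1) * innerRes z j k (l + 1) m x - innerRes z j k l (m + 1) x := by
  have hxz' : x - z ≠ 0 := sub_ne_zero.2 hxz
  have hzx : z - x ≠ 0 := sub_ne_zero.2 (Ne.symm hxz)
  by_cases hm : m ≤ j + k
  swap
  · rw [innerRes_of_lt (by omega), innerRes_of_lt (by omega), innerRes_of_lt (by omega)]
    ring
  set y₀ : ℝ := x / (x - z) with hy₀
  set g : ℝ[X] := X ^ k * (1 - X) ^ l with hg
  set d : ℕ := j + k - m with hd
  -- the two residues of order `d+1`
  have e1 : innerRes z j k (l + 1) m x = (taylor y₀ g * (1 - taylor y₀ X)).coeff d / (z - x) ^ (d + 1) := by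
    rw [innerRes_eq_taylor_coeff hm, pow_succ, ← mul_assoc, ← hg, taylor_mul, map_sub, taylor_one, C_1]
  have e0 : innerRes z j k l m x = (taylor y₀ g).coeff d / (z - x) ^ (d + 1) := by
    rw [innerRes_eq_taylor_coeff hm]
  -- the residue of order `d` (the term `I(h−1,j,k,l−1,m+1)`): a shifted Taylor coefficient
  have e2 : innerRes z j k l (m + 1) x = (taylor y₀ g * X).coeff d / (z - x) ^ d := by
    rcases Nat.eq_zero_or_pos d with hd0 | hdpos
    · rw [innerRes_of_lt (by omega), hd0, coeff_mul_X_zero, zero_div]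
    · obtain ⟨d', hd'⟩ : ∃ d', d = d' + 1 := ⟨d - 1, by omega⟩
      rw [innerRes_eq_taylor_coeff (by omega), hd', coeff_mul_X, show j + k - (m + 1) = d' by omega]
  -- the polynomial identity, after `taylor y₀` (`taylor y₀ (Y − y₀) = Y`):
  -- `(1−x)·T(g)(1 − T X) = z·T g − (z−1)·T(g)(1 − T X) − (z−x)·(T g · Y)`
  have hTX : taylor y₀ (X : ℝ[X]) = X + C y₀ := by rw [taylor_X]
  have key : C (1 - x) * (taylor y₀ g * (1 - taylor y₀ X)) =
      C z * taylor y₀ g - C (z - 1) * (taylor y₀ g * (1 - taylor y₀ X)) - C (z - x) * (taylor y₀ g * X) := by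
    have hc : (C z - C x) * C y₀ = -C x := by
      rw [← C_sub, ← C_mul, ← C_neg]
      congr 1
      rw [hy₀]
      field_simp
      ring
    simp only [hTX, C_sub, C_1]
    linear_combination (-(taylor y₀ g)) * hc
  have hcoeff := congrArg (fun q : ℝ[X] => q.coeff d) key
  simp only [coeff_sub, coeff_C_mul] at hcoeff
  rw [e1, e0, e2, pow_succ]
  field_simp
  linear_combination hcoeff

/-- **Rhin–Viola (2.41) for `I_z^{(1)}`** (`z > 1`; indices shifted so that `h, l ≥ 1` read `h+1, l+1`):
`I_z^{(1)}(h+1,j,k,l+1,m) = I_z^{(1)}(h,j,k,l,m) − (z−1) I_z^{(1)}(h,j,k,l+1,m) − I_z^{(1)}(h,j,k,l,m+1)`.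
[cite: RhinViola2005, (2.41)] -/
theorem I1_succ_h_succ_l {z : ℝ} (hz : 1 < z) (h j k l m : ℕ) :
    I1 z (h + 1) j k (l + 1) m =
      I1 z h j k l m - (z - 1) * I1 z h j k (l + 1) m - I1 z h j k l (m + 1) := by
  have hz0 : z ≠ 0 := by positivity
  have i0 := intervalIntegrable_I1_integrand hz h j k l m
  have i1 := intervalIntegrable_I1_integrand hz h j k (l + 1) m
  have i2 := intervalIntegrable_I1_integrand hz h j k l (m + 1)
  have hint : ∫ x in (0 : ℝ)..1, x ^ j * (1 - x) ^ (h + 1) * innerRes z j k (l + 1) m x =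
      z * (∫ x in (0 : ℝ)..1, x ^ j * (1 - x) ^ h * innerRes z j k l m x)
        - (z - 1) * (∫ x in (0 : ℝ)..1, x ^ j * (1 - x) ^ h * innerRes z j k (l + 1) m x)
        - ∫ x in (0 : ℝ)..1, x ^ j * (1 - x) ^ h * innerRes z j k l (m + 1) x := by
    rw [← intervalIntegral.integral_const_mul, ← intervalIntegral.integral_const_mul,
      ← integral_sub (i0.const_mul z) (i1.const_mul (z - 1)),
      ← integral_sub ((i0.const_mul z).sub (i1.const_mul (z - 1))) i2]
    refine integral_congr fun x hx => ?_
    have hx1 : x ≠ z := by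
      rw [uIcc_of_le zero_le_one] at hx
      exact fun h' => by linarith [hx.2]
    have key := one_sub_mul_innerRes_succ_l hx1 j k l m
    linear_combination x ^ j * (1 - x) ^ h * key
  have p1 : z ^ (-(((l + 1 : ℕ) : ℤ) + (m : ℤ))) = z⁻¹ * z ^ (-((l : ℤ) + m)) := by
    rw [Nat.cast_succ, show -(((l : ℤ) + 1) + m) = -((l : ℤ) + m) - 1 by ring, zpow_sub_one₀ hz0]
    ring
  have p2 : z ^ (-((l : ℤ) + ((m + 1 : ℕ) : ℤ))) = z⁻¹ * z ^ (-((l : ℤ) + m)) := by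
    rw [Nat.cast_succ, show -((l : ℤ) + ((m : ℤ) + 1)) = -((l : ℤ) + m) - 1 by ring, zpow_sub_one₀ hz0]
    ring
  simp only [I1]
  rw [hint, p1, p2]
  field_simp

/-- **Rhin–Viola (2.41) for `I_z = I_z^{(0)} − (log z) I_z^{(1)}`** (`z > 1`).
[cite: RhinViola2005, (2.41)] -/
theorem I_succ_h_succ_l {z : ℝ} (hz : 1 < z) (h j k l m : ℕ) :
    I z (h + 1) j k (l + 1) m = I z h j k l m - (z - 1) * I z h j k (l + 1) m - I z h j k l (m + 1) := by
  rw [I, I, I, I, I0_succ_h_succ_l hz.le, I1_succ_h_succ_l hz]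
  ring

end RhinViola

end Literature.NumberTheory.DiophantineApproximation

end
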